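import Mathlib
import Summits.Ventures.PercRepro2.HCov
import Summits.Ventures.PercRepro2.HCovCubic
import Summits.Ventures.PercRepro2.TriDisagreement
import Summits.Ventures.PercRepro2.TriDisagreementPinned
import Summits.Ventures.PercRepro2.TypedSplit
import Summits.Ventures.PercRepro2.OneTypedEdge

/-!
# The star of a degree-three unmarked vertex: pattern counts, pendant copies, the placement split
(blind cell PercRepro2, p1 g11; the typed-count host of LEAD-CCW §3⁗⁗″, ASSIGNMENTS v12.24 (a))

At an unmarked vertex `y` of degree three with star edges `s₁, s₂, s₃` (to `u₁, u₂, u₃`), the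
typed count with the star edges typed splits (`typedCount_split` three times) into the placements
— which copies carry each star edge — of a PATTERN count `patCount U₀ U₁ U₂`: the count over the
rest with the kernel `K₃` evaluated on the three copies updated at the star according to
`U_c ∈ Bool³` (a «one block per copy» hyperedge pattern, with `y` itself as the block). In a copy
where exactly one star edge is open `y` is pendant, hence invisible to every connection between
marks (`conn_update_false_pendant`), so that copy may be closed (`patCount_close_x` / `_y` / `_w`).
`StarIdentities.lean` splits the star into its placements and derives the three in-cone
identities of the lead's degree-three star cone from these.
-/

namespace Summit.Ventures.PercRepro2

open CovForm CovForm.OneTyped CovForm.TypedRed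

namespace StarPattern

/-! ## A pendant vertex is invisible between the other vertices -/

section Conn

variable {V : Type*} {E : Type*} [DecidableEq E]

/-- **Pendant invisibility**: if every edge at `y` other than `s = {y, u}` is a loop or closed in
`ω`, closing `s` does not change connectivity between vertices other than `y`. -/
theorem conn_update_false_pendant {ends : E → Sym2 V} {ω : Config E} {s : E} {y u : V}
    (hs : ends s = s(y, u)) (hyu : y ≠ u)
    (hcl : ∀ g, g ≠ s → y ∈ ends g → (ends g).IsDiag ∨ ω g = false) {x z : V} (hx : x ≠ y)
    (hz : z ≠ y) : Conn ends ω x z ↔ Conn ends (Function.update ω s false) x z := by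
  constructor
  · intro h
    set ω' := Function.update ω s false with hω'
    let S : Set V := {v | (v = y ∧ Conn ends ω' x u) ∨ (v ≠ y ∧ Conn ends ω' x v)}
    have hxS : x ∈ S := Or.inr ⟨hx, conn_refl _ _ _⟩
    have hS : ∀ a ∈ S, ∀ b, (openGraph ends ω).Adj a b → b ∈ S := by
      intro a ha b hadj
      obtain ⟨hab, g, hgo, hge⟩ := openGraph_adj.1 hadj
      by_cases hgs : g = s
      · subst hgs
        rw [hs, Sym2.eq_iff] at hge
        rcases hge with ⟨rfl, rfl⟩ | ⟨rfl, rfl⟩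
        · rcases ha with ⟨_, hc⟩ | ⟨hy, _⟩
          · exact Or.inr ⟨hyu.symm, hc⟩
          · exact absurd rfl hy
        · rcases ha with ⟨hy, _⟩ | ⟨_, hc⟩
          · exact absurd hy hyu.symm
          · exact Or.inl ⟨rfl, hc⟩
      · by_cases hyg : y ∈ ends g
        · rcases hcl g hgs hyg with hd | hc
          · exact absurd (by rw [hge, Sym2.mk_isDiag_iff] at hd; exact hd) hab
          · rw [hgo] at hc
            cases hc
        · have hay : a ≠ y := fun h => hyg (h ▸ hge ▸ Sym2.mem_mk_left a b)
          have hby : b ≠ y := fun h => hyg (h ▸ hge ▸ Sym2.mem_mk_right a b)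
          have hgo' : ω' g = true := by rw [hω', Function.update_of_ne hgs]; exact hgo
          rcases ha with ⟨hy, _⟩ | ⟨_, hc⟩
          · exact absurd hy hay
          · exact Or.inr ⟨hby, conn_trans hc (conn_of_openAdj ⟨g, hgo', hge⟩)⟩
    rcases mem_of_conn_of_closed hS hxS h with ⟨hy, _⟩ | ⟨_, hc⟩
    · exact absurd hy hz
    · exact hc
  · intro h
    refine conn_mono (fun g => ?_) h
    by_cases hgs : g = s
    · subst hgs
      simp
    · rw [Function.update_of_ne hgs]

end Conn

/-! ## Pattern counts at a degree-three star -/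

section Pattern

variable {V : Type*} {E : Type*} [Fintype E] [DecidableEq E] {R : Type*} [Field R]

/-- The configuration with the star `s₁, s₂, s₃` set to `U = (b₁, b₂, b₃)`. -/
def starSet (s₁ s₂ s₃ : E) (U : Bool × Bool × Bool) (x : Config E) : Config E :=
  Function.update (Function.update (Function.update x s₃ U.2.2) s₂ U.2.1) s₁ U.1

/-- The pattern kernel: `K₃` on the three copies with the star set to `U₀, U₁, U₂`. -/
noncomputable def patKernel (ends : E → Sym2 V) (o a₁ a₂ a₃ b : V) (s₁ s₂ s₃ : E)
    (U₀ U₁ U₂ : Bool × Bool × Bool) : Config E → Config E → Config E → R :=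
  fun x y w => K3 ends o a₁ a₂ a₃ b (starSet s₁ s₂ s₃ U₀ x) (starSet s₁ s₂ s₃ U₁ y)
    (starSet s₁ s₂ s₃ U₂ w)

/-- The pattern count: the typed count over `F₀` (the star removed) of the pattern kernel. -/
noncomputable def patCount (ends : E → Sym2 V) (o a₁ a₂ a₃ b : V) (s₁ s₂ s₃ : E) (F₀ : Finset E)
    (z₀ : Config E) (τ : E → ℕ) (U₀ U₁ U₂ : Bool × Bool × Bool) : R :=
  typedCount F₀ z₀ τ (patKernel ends o a₁ a₂ a₃ b s₁ s₂ s₃ U₀ U₁ U₂)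

end Pattern

/-! ## Closing a pendant copy -/

section Close

variable {V : Type*} {E : Type*} [Fintype E] [DecidableEq E] {R : Type*} [Field R]

omit [Fintype E] in
/-- The state does not see a pendant edge. -/
lemma st_update_false_pendant (ends : E → Sym2 V) (o a₁ a₂ a₃ b : V) {ω : Config E} {s : E}
    {y u : V} (hs : ends s = s(y, u)) (hyu : y ≠ u)
    (hcl : ∀ g, g ≠ s → y ∈ ends g → (ends g).IsDiag ∨ ω g = false) (hyo : y ≠ o) (hy1 : y ≠ a₁)
    (hy2 : y ≠ a₂) (hy3 : y ≠ a₃) (hyb : y ≠ b) :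
    st ends o a₁ a₂ a₃ b ω = st ends o a₁ a₂ a₃ b (Function.update ω s false) := by
  have h := fun (x z : V) (hx : x ≠ y) (hz : z ≠ y) => conn_update_false_pendant hs hyu hcl hx hz
  unfold st
  simp only [Prod.mk.injEq]
  exact ⟨decide_eq_decide.mpr (h _ _ hy2.symm hy1.symm), decide_eq_decide.mpr (h _ _ hy1.symm hyo.symm),
    decide_eq_decide.mpr (h _ _ hy2.symm hyo.symm), decide_eq_decide.mpr (h _ _ hy1.symm hyb.symm),
    decide_eq_decide.mpr (h _ _ hy2.symm hyb.symm), decide_eq_decide.mpr (h _ _ hy1.symm hy3.symm),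
    decide_eq_decide.mpr (h _ _ hy2.symm hy3.symm)⟩

omit [Fintype E] in
/-- The typed count only sees the kernel on the counted triples. -/
lemma typedCount_congr_on [Fintype E] (F : Finset E) (z : Config E) (τ : E → ℕ)
    {K K' : Config E → Config E → Config E → R}
    (h : ∀ x y w, (∀ e, e ∉ F → x e = z e ∧ y e = z e ∧ w e = z e) →
      (∀ e ∈ F, openCount x y w e = τ e) → K x y w = K' x y w) :
    typedCount F z τ K = typedCount F z τ K' := by
  unfold typedCount
  refine Finset.sum_congr rfl fun x _ => Finset.sum_congr rfl fun y _ =>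
    Finset.sum_congr rfl fun w _ => ?_
  split_ifs with hc
  · exact h x y w hc.1 hc.2
  · rfl

omit [Fintype E] in
/-- `starSet` on a configuration with the star closed is the explicit three-way update. -/
lemma starSet_apply {s₁ s₂ s₃ : E} (h12 : s₁ ≠ s₂) (h13 : s₁ ≠ s₃) (h23 : s₂ ≠ s₃)
    (U : Bool × Bool × Bool) (x : Config E) (g : E) :
    starSet s₁ s₂ s₃ U x g =
      if g = s₁ then U.1 else if g = s₂ then U.2.1 else if g = s₃ then U.2.2 else x g := by
  unfold starSet
  by_cases hg1 : g = s₁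
  · subst hg1; simp
  by_cases hg2 : g = s₂
  · subst hg2; simp [h12.symm]
  by_cases hg3 : g = s₃
  · subst hg3; simp [h13.symm, h23.symm]
  simp [hg1, hg2, hg3]

end Close

section Close2

variable {V : Type*} {E : Type*} [Fintype E] [DecidableEq E] {R : Type*} [Field R]

omit [Fintype E] in
/-- Closing `s₁` in the star configuration `(true, false, false)` gives the closed star. -/
lemma update_starSet_one {s₁ s₂ s₃ : E} (h12 : s₁ ≠ s₂) (h13 : s₁ ≠ s₃) (h23 : s₂ ≠ s₃)
    (x : Config E) :
    Function.update (starSet s₁ s₂ s₃ (true, false, false) x) s₁ false =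
      starSet s₁ s₂ s₃ (false, false, false) x := by
  funext g
  by_cases hg : g = s₁
  · subst hg; simp [starSet_apply h12 h13 h23]
  · rw [Function.update_of_ne hg, starSet_apply h12 h13 h23, starSet_apply h12 h13 h23, if_neg hg,
      if_neg hg]

omit [Fintype E] in
/-- Closing `s₂` in the star configuration `(false, true, false)` gives the closed star. -/
lemma update_starSet_two {s₁ s₂ s₃ : E} (h12 : s₁ ≠ s₂) (h13 : s₁ ≠ s₃) (h23 : s₂ ≠ s₃)
    (x : Config E) :
    Function.update (starSet s₁ s₂ s₃ (false, true, false) x) s₂ false =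
      starSet s₁ s₂ s₃ (false, false, false) x := by
  funext g
  by_cases hg : g = s₂
  · subst hg; simp [starSet_apply h12 h13 h23, h12.symm]
  · rw [Function.update_of_ne hg, starSet_apply h12 h13 h23, starSet_apply h12 h13 h23]
    by_cases hg1 : g = s₁
    · simp [hg1]
    · rw [if_neg hg1, if_neg hg1, if_neg hg, if_neg hg]

omit [Fintype E] in
/-- Closing `s₃` in the star configuration `(false, false, true)` gives the closed star. -/
lemma update_starSet_three {s₁ s₂ s₃ : E} (h12 : s₁ ≠ s₂) (h13 : s₁ ≠ s₃) (h23 : s₂ ≠ s₃)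
    (x : Config E) :
    Function.update (starSet s₁ s₂ s₃ (false, false, true) x) s₃ false =
      starSet s₁ s₂ s₃ (false, false, false) x := by
  funext g
  by_cases hg : g = s₃
  · subst hg; simp [starSet_apply h12 h13 h23, h13.symm, h23.symm]
  · rw [Function.update_of_ne hg, starSet_apply h12 h13 h23, starSet_apply h12 h13 h23]
    by_cases hg1 : g = s₁
    · simp [hg1]
    · by_cases hg2 : g = s₂
      · simp [hg2]
      · rw [if_neg hg1, if_neg hg1, if_neg hg2, if_neg hg2, if_neg hg, if_neg hg]

omit [Fintype E] in
/-- **A pendant copy may be closed**: on a configuration `x` with the star closed and every other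
edge at `y` a loop or closed, the state of `starSet U x` for a singleton `U` is the state of the
closed star. -/
theorem st_starSet_single (ends : E → Sym2 V) (o a₁ a₂ a₃ b : V) {s₁ s₂ s₃ : E} {y u₁ u₂ u₃ : V}
    (h12 : s₁ ≠ s₂) (h13 : s₁ ≠ s₃) (h23 : s₂ ≠ s₃) (hs₁ : ends s₁ = s(y, u₁))
    (hs₂ : ends s₂ = s(y, u₂)) (hs₃ : ends s₃ = s(y, u₃)) (hyu₁ : y ≠ u₁) (hyu₂ : y ≠ u₂)
    (hyu₃ : y ≠ u₃) (hyo : y ≠ o) (hy1 : y ≠ a₁) (hy2 : y ≠ a₂) (hy3 : y ≠ a₃) (hyb : y ≠ b)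
    {x : Config E} (hcl : ∀ g, g ≠ s₁ → g ≠ s₂ → g ≠ s₃ → y ∈ ends g → (ends g).IsDiag ∨ x g = false)
    {U : Bool × Bool × Bool}
    (hU : U = (true, false, false) ∨ U = (false, true, false) ∨ U = (false, false, true)) :
    st ends o a₁ a₂ a₃ b (starSet s₁ s₂ s₃ U x) =
      st ends o a₁ a₂ a₃ b (starSet s₁ s₂ s₃ (false, false, false) x) := by
  -- the single open star edge `s` with far end `u`
  rcases hU with hU | hU | hU
  · subst hU
    rw [st_update_false_pendant ends o a₁ a₂ a₃ b hs₁ hyu₁ (ω := starSet s₁ s₂ s₃ (true, false, false) x)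
      ?_ hyo hy1 hy2 hy3 hyb, update_starSet_one h12 h13 h23 x]
    intro g hg hyg
    by_cases hg2 : g = s₂
    · subst hg2; right; simp [starSet_apply h12 h13 h23, h12.symm]
    by_cases hg3 : g = s₃
    · subst hg3; right; simp [starSet_apply h12 h13 h23, h13.symm, h23.symm]
    rcases hcl g hg hg2 hg3 hyg with hd | hc
    · exact Or.inl hd
    · right; simp [starSet_apply h12 h13 h23, hg, hg2, hg3, hc]
  · subst hU
    rw [st_update_false_pendant ends o a₁ a₂ a₃ b hs₂ hyu₂ (ω := starSet s₁ s₂ s₃ (false, true, false) x)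
      ?_ hyo hy1 hy2 hy3 hyb, update_starSet_two h12 h13 h23 x]
    intro g hg hyg
    by_cases hg1 : g = s₁
    · subst hg1; right; simp [starSet_apply h12 h13 h23]
    by_cases hg3 : g = s₃
    · subst hg3; right; simp [starSet_apply h12 h13 h23, h13.symm, h23.symm]
    rcases hcl g hg1 hg hg3 hyg with hd | hc
    · exact Or.inl hd
    · right; simp [starSet_apply h12 h13 h23, hg, hg1, hg3, hc]
  · subst hU
    rw [st_update_false_pendant ends o a₁ a₂ a₃ b hs₃ hyu₃ (ω := starSet s₁ s₂ s₃ (false, false, true) x)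
      ?_ hyo hy1 hy2 hy3 hyb, update_starSet_three h12 h13 h23 x]
    intro g hg hyg
    by_cases hg1 : g = s₁
    · subst hg1; right; simp [starSet_apply h12 h13 h23]
    by_cases hg2 : g = s₂
    · subst hg2; right; simp [starSet_apply h12 h13 h23, h12.symm]
    rcases hcl g hg1 hg2 hg hyg with hd | hc
    · exact Or.inl hd
    · right; simp [starSet_apply h12 h13 h23, hg, hg1, hg2, hc]

end Close2

/-! ## Closing a pendant copy of a pattern count; the split of the star -/

section PatCount

variable {V : Type*} {E : Type*} [Fintype E] [DecidableEq E] {R : Type*} [Field R]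

/-- The standing data of a degree-three star at the unmarked vertex `y`, with the star removed
from the typed set `F₀` and pinned closed in `z₀`, every other edge at `y` a loop or pinned closed. -/
structure StarData (ends : E → Sym2 V) (o a₁ a₂ a₃ b : V) (s₁ s₂ s₃ : E) (y u₁ u₂ u₃ : V)
    (F₀ : Finset E) (z₀ : Config E) : Prop where
  h12 : s₁ ≠ s₂
  h13 : s₁ ≠ s₃
  h23 : s₂ ≠ s₃
  hs₁ : ends s₁ = s(y, u₁)
  hs₂ : ends s₂ = s(y, u₂)
  hs₃ : ends s₃ = s(y, u₃)
  hyu₁ : y ≠ u₁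
  hyu₂ : y ≠ u₂
  hyu₃ : y ≠ u₃
  hyo : y ≠ o
  hy1 : y ≠ a₁
  hy2 : y ≠ a₂
  hy3 : y ≠ a₃
  hyb : y ≠ b
  hF₁ : s₁ ∉ F₀
  hF₂ : s₂ ∉ F₀
  hF₃ : s₃ ∉ F₀
  hcl : ∀ g, g ≠ s₁ → g ≠ s₂ → g ≠ s₃ → y ∈ ends g → (ends g).IsDiag ∨ (g ∉ F₀ ∧ z₀ g = false)

variable {ends : E → Sym2 V} {o a₁ a₂ a₃ b : V} {s₁ s₂ s₃ : E} {y u₁ u₂ u₃ : V} {F₀ : Finset E}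
  {z₀ : Config E}

omit [Fintype E] [DecidableEq E] in
/-- On a counted configuration every non-star edge at `y` is a loop or closed. -/
lemma StarData.closed_at (D : StarData ends o a₁ a₂ a₃ b s₁ s₂ s₃ y u₁ u₂ u₃ F₀ z₀) {x : Config E}
    (hx : ∀ e, e ∉ F₀ → x e = z₀ e) :
    ∀ g, g ≠ s₁ → g ≠ s₂ → g ≠ s₃ → y ∈ ends g → (ends g).IsDiag ∨ x g = false := by
  intro g hg1 hg2 hg3 hyg
  rcases D.hcl g hg1 hg2 hg3 hyg with hd | ⟨hgF, hz⟩
  · exact Or.inl hd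
  · exact Or.inr ((hx g hgF).trans hz)

/-- **Closing a pendant first copy.** -/
theorem patCount_close_x (D : StarData ends o a₁ a₂ a₃ b s₁ s₂ s₃ y u₁ u₂ u₃ F₀ z₀) (τ : E → ℕ)
    {U₀ : Bool × Bool × Bool}
    (hU : U₀ = (true, false, false) ∨ U₀ = (false, true, false) ∨ U₀ = (false, false, true))
    (U₁ U₂ : Bool × Bool × Bool) :
    patCount (R := R) ends o a₁ a₂ a₃ b s₁ s₂ s₃ F₀ z₀ τ U₀ U₁ U₂ =
      patCount ends o a₁ a₂ a₃ b s₁ s₂ s₃ F₀ z₀ τ (false, false, false) U₁ U₂ := by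
  unfold patCount patKernel
  refine typedCount_congr_on F₀ z₀ τ fun x y' w hpin _ => ?_
  rw [K3_eq_KB, K3_eq_KB, st_starSet_single ends o a₁ a₂ a₃ b D.h12 D.h13 D.h23 D.hs₁ D.hs₂ D.hs₃
    D.hyu₁ D.hyu₂ D.hyu₃ D.hyo D.hy1 D.hy2 D.hy3 D.hyb (D.closed_at fun e he => (hpin e he).1) hU]

/-- **Closing a pendant second copy.** -/
theorem patCount_close_y (D : StarData ends o a₁ a₂ a₃ b s₁ s₂ s₃ y u₁ u₂ u₃ F₀ z₀) (τ : E → ℕ)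
    (U₀ : Bool × Bool × Bool) {U₁ : Bool × Bool × Bool}
    (hU : U₁ = (true, false, false) ∨ U₁ = (false, true, false) ∨ U₁ = (false, false, true))
    (U₂ : Bool × Bool × Bool) :
    patCount (R := R) ends o a₁ a₂ a₃ b s₁ s₂ s₃ F₀ z₀ τ U₀ U₁ U₂ =
      patCount ends o a₁ a₂ a₃ b s₁ s₂ s₃ F₀ z₀ τ U₀ (false, false, false) U₂ := by
  unfold patCount patKernel
  refine typedCount_congr_on F₀ z₀ τ fun x y' w hpin _ => ?_
  rw [K3_eq_KB, K3_eq_KB, st_starSet_single ends o a₁ a₂ a₃ b D.h12 D.h13 D.h23 D.hs₁ D.hs₂ D.hs₃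
    D.hyu₁ D.hyu₂ D.hyu₃ D.hyo D.hy1 D.hy2 D.hy3 D.hyb (D.closed_at fun e he => (hpin e he).2.1) hU]

/-- **Closing a pendant third copy.** -/
theorem patCount_close_w (D : StarData ends o a₁ a₂ a₃ b s₁ s₂ s₃ y u₁ u₂ u₃ F₀ z₀) (τ : E → ℕ)
    (U₀ U₁ : Bool × Bool × Bool) {U₂ : Bool × Bool × Bool}
    (hU : U₂ = (true, false, false) ∨ U₂ = (false, true, false) ∨ U₂ = (false, false, true)) :
    patCount (R := R) ends o a₁ a₂ a₃ b s₁ s₂ s₃ F₀ z₀ τ U₀ U₁ U₂ =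
      patCount ends o a₁ a₂ a₃ b s₁ s₂ s₃ F₀ z₀ τ U₀ U₁ (false, false, false) := by
  unfold patCount patKernel
  refine typedCount_congr_on F₀ z₀ τ fun x y' w hpin _ => ?_
  rw [K3_eq_KB, K3_eq_KB, st_starSet_single ends o a₁ a₂ a₃ b D.h12 D.h13 D.h23 D.hs₁ D.hs₂ D.hs₃
    D.hyu₁ D.hyu₂ D.hyu₃ D.hyo D.hy1 D.hy2 D.hy3 D.hyb (D.closed_at fun e he => (hpin e he).2.2) hU]

end PatCount

section Split

variable {E : Type*} [DecidableEq E] {R : Type*} [CommRing R]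

/-- The three placements of a type-`1` edge: open in exactly one copy. -/
def placements : Finset (Bool × Bool × Bool) :=
  {(true, false, false), (false, true, false), (false, false, true)}

/-- The sum over `Bool³` with exactly one `true` is the sum over the three placements. -/
lemma sum_bool3_one (f : Bool → Bool → Bool → R) :
    (∑ a : Bool, ∑ b : Bool, ∑ c : Bool, if a.toNat + b.toNat + c.toNat = 1 then f a b c else 0) =
      f true false false + f false true false + f false false true := by
  simp
  ring

/-- The sum over the three placements, expanded. -/
lemma sum_placements (f : Bool × Bool × Bool → R) :
    (∑ p ∈ placements, f p) =
      f (true, false, false) + f (false, true, false) + f (false, false, true) := by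
  simp [placements, Finset.sum_insert]
  ring

/-- The three placements of a type-`2` edge: open in exactly two copies. -/
def placements2 : Finset (Bool × Bool × Bool) :=
  {(true, true, false), (true, false, true), (false, true, true)}

/-- The sum over `Bool³` with exactly two `true` is the sum over the three type-`2` placements. -/
lemma sum_bool3_two (f : Bool → Bool → Bool → R) :
    (∑ a : Bool, ∑ b : Bool, ∑ c : Bool, if a.toNat + b.toNat + c.toNat = 2 then f a b c else 0) =
      f true true false + f true false true + f false true true := by
  simp

/-- The sum over the type-`2` placements, expanded. -/
lemma sum_placements2 (f : Bool × Bool × Bool → R) :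
    (∑ p ∈ placements2, f p) =
      f (true, true, false) + f (true, false, true) + f (false, true, true) := by
  simp [placements2, Finset.sum_insert]
  ring

/-- The sum over `Bool³` with three `true` is the single term. -/
lemma sum_bool3_three (f : Bool → Bool → Bool → R) :
    (∑ a : Bool, ∑ b : Bool, ∑ c : Bool, if a.toNat + b.toNat + c.toNat = 3 then f a b c else 0) =
      f true true true := by
  simp

end Split



end StarPattern

end Summit.Ventures.PercRepro2
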